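import Literature.NumberTheory.LFunctions.DworkRationalityLifting
import Literature.NumberTheory.LFunctions.DworkRationalitySplittingValues
import Mathlib.FieldTheory.IsAlgClosed.Basic
import HarnessLib

/-!
# Dwork's splitting function exists: discharge of the named fact `Dwork.dworkSplitting`

Part of the bottom-up proof of Dwork's rationality theorem
(`Literature/NumberTheory/LFunctions/DworkRationality.lean`). The file
`…/DworkRationalityLifting.lean` vendors, as the named fact
`Literature.NumberTheory.LFunctions.Dwork.dworkSplitting` (Koblitz, GTM 58, Ch. V §2,
pp. 126–128), the existence of *Dwork's splitting function*: an overconvergent `Θ ∈ ℂ_p⟦T⟧` and a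
primitive `p`-th root of unity `ε` with `∏_{e<N} Θ(t^{pᵉ}) = ε^{c mod p}` whenever `t^{p^N} = t`
and `∑_{e<N} t^{pᵉ} = c ∈ ℤ_p`. This file **proves** it
(`Literature.NumberTheory.LFunctions.Dwork.dworkSplitting_holds`), with the witness

* `Θ = θ_π = exp(π(X - Xᵖ))` for a root `π ∈ ℂ_p` of `π^{p-1} = -p` (Dwork's splitting function in
  the form of Dwork, Amer. J. Math. 82 (1960), §4, and Lang, *Cyclotomic Fields I and II*, Ch. 14
  §2, "Dwork's power series `E_π(X)`"; `Dwork.splitting` of `…/DworkRationalitySplitting.lean`;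
  `π` exists because `ℂ_p` is algebraically closed), and
* `ε = θ_π(1)`,

all the analysis being already in the tree: `θ_π ∈ R₀` is Lang's Lemma 2.2
(`Dwork.isOverconvergent_splitting`, `…/DworkRationalitySplittingSeries.lean`); `εᵖ = 1 ≠ ε` is
Lang's Thm. 3.2 (Dwork) (`Dwork.evalOne_splitting_one_pow`, `Dwork.evalOne_splitting_one_ne_one`)
and the product formula `∏_{i<M} θ_π(z^{pⁱ}) = θ_π(1)ⁿ` for `‖∑_{i<M} z^{pⁱ} - n‖ < 1` is Lang's
Thm. 3.3 (Dwork) (`Dwork.prod_evalOne_splitting_eq_pow`), both in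
`…/DworkRationalitySplittingValues.lean`. What is added here is the bookkeeping: a point with
`t^{p^N} = t` lies in the closed unit disc, `∑_{e<N} t^{pᵉ} = c ∈ ℤ_p` is at distance `< 1` from the
natural number `c mod p ∈ {0, …, p-1}` (Koblitz, p. 126: the reduction of `Tr_K t` is `Tr a`), and a
`p`-th root of unity `≠ 1` is primitive, `p` being prime.

Koblitz reaches the same conclusion (p. 128: "we have found a `p`-adic power series
`Θ(T) = ∑ aₙTⁿ` … such that the character `a ↦ ε^{Tr a}` … can be obtained by evaluating
`Θ(T)Θ(Tᵖ)⋯Θ(T^{p^{s-1}})` at the Teichmüller lifting of `a`") with the witness `Θ(T) = F(T, λ)`,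
`λ = ε - 1`; the vendored fact only asserts existence, so Dwork's original `exp(π(X - Xᵖ))` serves.

## References

* N. Koblitz, *p-adic Numbers, p-adic Analysis, and Zeta-Functions*, 2nd ed., GTM 58 (1984),
  Ch. V §2, pp. 126–128. [Koblitz1984]
* S. Lang, *Cyclotomic Fields I and II*, GTM 121 (1990), Ch. 14 §2 (Lemma 2.2), §3 (Lemma 3.1,
  Thm. 3.2 (Dwork), Thm. 3.3 (Dwork)). [Lang1990]
* B. Dwork, *On the rationality of the zeta function of an algebraic variety*, Amer. J. Math. 82
  (1960), 631–648, §4. [Dwork1960]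
-/

open Finset

noncomputable section

namespace Literature.NumberTheory.LFunctions

namespace Dwork

variable {p : ℕ} [Fact p.Prime]

/-! ### Bookkeeping at Teichmüller points -/

/-- A point `t ∈ ℂ_p` with `t^{p^N} = t`, `N ≥ 1`, lies in the closed unit disc (it is `0` or a
`(p^N - 1)`-th root of unity; Koblitz, Ch. V §2, p. 128: the Teichmüller representatives "lie
precisely at radius 1"). [cite: Koblitz1984, Ch. V §2 p. 128] -/
theorem norm_le_one_of_pow_eq_self {N : ℕ} (hN : 0 < N) {t : ℂ_[p]} (ht : t ^ p ^ N = t) :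
    ‖t‖ ≤ 1 := by
  have hp : p.Prime := Fact.out
  rcases le_or_gt ‖t‖ 1 with h | h
  · exact h
  · exfalso
    have h2 : 1 < p ^ N := Nat.one_lt_pow hN.ne' hp.one_lt
    have hlt : ‖t‖ ^ 1 < ‖t‖ ^ (p ^ N) := pow_lt_pow_right₀ h h2
    rw [pow_one, ← norm_pow, ht] at hlt
    exact lt_irrefl _ hlt

/-- If `∑_{e<N} t^{pᵉ} = c ∈ ℤ_p` then `∑_{e<N} t^{pᵉ} ≡ (c mod p) (mod 𝔪)`: the sum is at distance
`< 1` from the natural number `(c mod p) ∈ {0, …, p-1}` (Koblitz, Ch. V §2, p. 126: "the reduction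
mod `p` of `Tr_K t` is … `Tr a ∈ 𝔽_p`", and "`ε` raised to a power in `ℤ_p` depends only on the
congruence class mod `p`"). [cite: Koblitz1984, Ch. V §2 p. 126] -/
theorem norm_sum_sub_val_toZMod_lt_one {N : ℕ} {t : ℂ_[p]} {c : ℤ_[p]}
    (hc : (∑ e ∈ range N, t ^ p ^ e) = algebraMap ℚ_[p] ℂ_[p] (c : ℚ_[p])) :
    ‖∑ e ∈ range N, t ^ p ^ e - ((PadicInt.toZMod c).val : ℂ_[p])‖ < 1 := by
  have hmem : c - (c.zmodRepr : ℤ_[p]) ∈ IsLocalRing.maximalIdeal ℤ_[p] :=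
    PadicInt.sub_zmodRepr_mem c
  rw [IsLocalRing.mem_maximalIdeal, PadicInt.mem_nonunits] at hmem
  have hcast : ((PadicInt.toZMod c).val : ℂ_[p]) =
      algebraMap ℚ_[p] ℂ_[p] (((c.zmodRepr : ℤ_[p]) : ℚ_[p])) := by
    rw [PadicInt.val_toZMod_eq_zmodRepr, PadicInt.coe_natCast, map_natCast]
  rw [hc, hcast, ← map_sub, ← PadicInt.coe_sub, norm_algebraMap', PadicInt.padic_norm_e_of_padicInt]
  exact hmem

/-- For `π^{p-1} = -p`, the value `ε = θ_π(1)` of Dwork's splitting function is a **primitive**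
`p`-th root of unity: `εᵖ = 1` and `ε ≠ 1` (Lang, *Cyclotomic Fields I and II*, Ch. 14 §3,
Thm. 3.2 (Dwork)), and `p` is prime. [cite: Lang1990, Ch. 14 §3 Thm. 3.2] -/
theorem isPrimitiveRoot_evalOne_splitting_one {π : ℂ_[p]} (hπ : π ^ (p - 1) = -p) :
    IsPrimitiveRoot (evalOne p (splitting p π) 1) p := by
  have h := IsPrimitiveRoot.orderOf (evalOne p (splitting p π) 1)
  rwa [orderOf_eq_prime (evalOne_splitting_one_pow hπ) (evalOne_splitting_one_ne_one hπ)] at h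

/-- There is `π ∈ ℂ_p` with `π^{p-1} = -p` (`ℂ_p` is algebraically closed; Lang, Ch. 14 §3: "we let
`π ∈ ℂ_p` be an element such that `π^{p-1} = -p`"). [cite: Lang1990, Ch. 14 §3] -/
theorem exists_pi_pow_eq_neg_p : ∃ π : ℂ_[p], π ^ (p - 1) = -p :=
  IsAlgClosed.exists_pow_nat_eq (-(p : ℂ_[p])) (Nat.sub_pos_of_lt (Fact.out : p.Prime).one_lt)

/-! ### The discharge -/

/-- **Fact A holds: Dwork's splitting function exists** (Koblitz, Ch. V §2, pp. 126–128; Dwork,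
Amer. J. Math. 82 (1960), §4; Lang, *Cyclotomic Fields I and II*, Ch. 14 §2–§3). Witness: for a
root `π ∈ ℂ_p` of `π^{p-1} = -p`, the series `Θ = θ_π = exp(π(X - Xᵖ)) ∈ ℂ_p⟦X⟧`
(`Dwork.splitting p π`) and `ε = θ_π(1)`. Then `Θ ∈ R₀` (Lang, Ch. 14 §2, Lemma 2.2:
`Dwork.isOverconvergent_splitting`); `ε` is a primitive `p`-th root of unity (Lang, Ch. 14 §3,
Thm. 3.2: `Dwork.isPrimitiveRoot_evalOne_splitting_one`); and for `t^{p^N} = t`, `N ≥ 1`, with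
`∑_{e<N} t^{pᵉ} = c ∈ ℤ_p` one has `‖t‖ ≤ 1` and `∑_{e<N} t^{pᵉ} ≡ (c mod p) (mod 𝔪)`, whence
`∏_{e<N} Θ(t^{pᵉ}) = ε^{c mod p}` by the splitting identity (Lang, Ch. 14 §3, Thm. 3.3:
`Dwork.prod_evalOne_splitting_eq_pow`), read through `Dwork.evalOne = Dwork.evalAt` on
`ℂ_p⟦X⟧ = MvPowerSeries Unit ℂ_p` (`Dwork.evalOne_eq_evalAt`). This is Koblitz's conclusion on
p. 128, reached through Dwork's original `exp(π(X - Xᵖ))` rather than Koblitz's `F(T, λ)`.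
[cite: Koblitz1984, Ch. V §2 pp. 126–128] [cite: Lang1990, Ch. 14 §3 Thms. 3.2–3.3] [cite: Dwork1960, §4] -/
theorem dworkSplitting_holds : dworkSplitting := by
  intro p _
  obtain ⟨π, hπ⟩ := exists_pi_pow_eq_neg_p (p := p)
  refine ⟨splitting p π, evalOne p (splitting p π) 1, isPrimitiveRoot_evalOne_splitting_one hπ,
    isOverconvergent_splitting hπ, ?_⟩
  intro N hN t ht c hc
  have hprod := prod_evalOne_splitting_eq_pow hπ (norm_le_one_of_pow_eq_self hN ht) ht
    (norm_sum_sub_val_toZMod_lt_one hc)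
  simpa only [evalOne_eq_evalAt] using hprod

end Dwork

end Literature.NumberTheory.LFunctions
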